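import Literature.Barriers.CriticalPhenomena.RigorousRGSmallParameterScalingFunctionRegularity
import HarnessLib

/-!
# `RigorousRGSmallParameter` (Slade, Theorem 1.4.1): strict positivity of `⟨c₀,c₀⟩ = ∫c₀(y,0)²dy`

Tenth file of the §10.3–§10.4 layer: the strict positivity "with the first term strictly positive"
in the proof of Lemma 5.2.2 (G. Slade, *Critical exponents for long-range `O(n)` models below the
upper critical dimension*, Commun. Math. Phys. **358** (2018), §10.4: "it follows from the Parseval
equality, together with the nonnegativity of the Fourier transform `ĉ₀`, that each inner product on
the right-hand side of (10.48) is nonnegative, with the first term strictly positive"), which makes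
the fixed-point parameter `a = L^ε(8+n)(⟨c₀,c₀⟩ + 2Σ_kL^{-εk}⟨c₀,c_k⟩)` positive.

Here `⟨c₀,c₀⟩ = ∫_{ℝ^d}c₀(y,0)²dy > 0` is proved directly (no Fourier analysis): the profile
`f = Re F ≥ 0` is continuous and not the zero function (`∫_0^∞uf(u)du > 0`, the tree's
`FRD.integral_mul_profile_re_pos`), so `f ≥ η > 0` on an interval `[a,b] ⊂ (0,∞)`; hence
`w̄(0;σ') = (2π)^{-d}∫f(√(|u|₂²+σ'))du ≥ c_w > 0` for `σ' ≤ (b²-a²)/2`, the inner kernel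
`G_L(0,σ) ≥ c_G > 0` for small `σ`, `c₀(0,0) = ∫G_L(0,σ)ρ(σ,0)dσ > 0` (`ρ(σ,0) = (sin πβ/π)σ^{-β}`),
and finally `c₀(y,0) ≥ ½c₀(0,0)` on a ball by the Lipschitz bound of
`RigorousRGSmallParameterScalingFunctionRegularity`.

## What this file proves (everything; no definition, no named fact)

* `FRD.exists_profile_re_ge` (`f ≥ η > 0` on some `[a,b] ⊂ (0,∞)`),
  `FRD.integrable_profile_sqrt_sqNorm`, `FRD.wbar_zero_eq`, `FRD.wbar_zero_nonneg`,
  `FRD.exists_wbar_zero_ge` (`w̄(0;σ') ≥ c_w` for `σ' ∈ [0,σ₁]`).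
* `FRD.cZeroKer_zero_nonneg`, `FRD.exists_cZeroKer_zero_ge` (`G_L(0,σ) ≥ c_G` for `σ ∈ [0,σ₂]`),
  `FRD.katoDensity_zero_mass` (`ρ^{(β)}(s,0) = (sin πβ/π)s^{-β}`), **`FRD.cZero_zero_zero_pos`**
  (`c₀(0,0) > 0`).
* **`FRD.integral_cZero_sq_pos`** — `∫c₀(y,0)² dy > 0`.
-/

noncomputable section

namespace Literature.Barriers.CriticalPhenomena

open _root_.MeasureTheory Set Filter
open scoped _root_.Topology Real

namespace LongRangePhi4

namespace FRD

open Literature.Probability.LatticeModels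

variable {d : ℕ}

/-! ### The profile is positive on an interval -/

/-- **`f = Re F` is bounded below by some `η > 0` on some interval `[a,b] ⊂ (0,∞)`** (it is
continuous, nonnegative and `∫_0^∞ u f(u) du > 0`). [cite: BauerschmidtBrydgesSlade2019RG, Ch. 3, "Finite-range decomposition: continuum" ("We assume that f is not the zero function")] -/
theorem exists_profile_re_ge :
    ∃ a b η : ℝ, 0 < a ∧ a < b ∧ 0 < η ∧ ∀ v ∈ Icc a b, η ≤ (profile v).re := by
  -- some `u₀ > 0` with `f(u₀) > 0`
  have hex : ∃ u₀ : ℝ, 0 < u₀ ∧ 0 < (profile u₀).re := by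
    by_contra h
    push Not at h
    have hzero : ∫ u in Ioi (0 : ℝ), u * (profile u).re = 0 := by
      rw [setIntegral_congr_fun measurableSet_Ioi (g := fun _ => (0 : ℝ)) fun u hu => by
        have hu0 : (0 : ℝ) < u := hu
        have := le_antisymm (h u hu0) (profile_re_nonneg u)
        simp [this]]
      simp
    have := integral_mul_profile_re_pos
    rw [hzero] at this
    exact lt_irrefl _ this
  obtain ⟨u₀, hu₀, hf₀⟩ := hex
  have hcont : Continuous fun v : ℝ => (profile v).re := Complex.continuous_re.comp profile.continuous
  have hct := Metric.continuous_iff.1 hcont u₀ ((profile u₀).re / 2) (by positivity)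
  obtain ⟨δ, hδ, hδ'⟩ := hct
  refine ⟨max (u₀ - δ / 2) (u₀ / 2), u₀ + δ / 2, (profile u₀).re / 2, ?_, ?_, by positivity, fun v hv => ?_⟩
  · exact lt_of_lt_of_le (by positivity) (le_max_right _ _)
  · refine max_lt (by linarith) (by linarith)
  · have hv1 : u₀ - δ / 2 ≤ v := le_trans (le_max_left _ _) hv.1
    have hv2 : v ≤ u₀ + δ / 2 := hv.2
    have hdist : dist v u₀ < δ := by
      rw [Real.dist_eq, abs_lt]; constructor <;> linarith
    have := hδ' v hdist
    rw [Real.dist_eq, abs_lt] at this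
    linarith [this.1]

/-! ### `w̄(0;σ')` is bounded below for small `σ'` -/

/-- Integrability of `u ↦ f(√(|u|₂²+σ'))` on `ℝ^d` (`σ' ≥ 0`, `d ≥ 1`). [folklore] -/
theorem integrable_profile_sqrt_sqNorm (hd : 1 ≤ d) {σ : ℝ} (hσ : 0 ≤ σ) :
    Integrable fun u : Fin d → ℝ => (profile (Real.sqrt (sqNorm u + σ))).re := by
  have hsq : Continuous (sqNorm : (Fin d → ℝ) → ℝ) := by
    unfold sqNorm
    fun_prop
  obtain ⟨C', hC', hf'⟩ := abs_profile_sqrt_le profile d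
  have hgi' : Integrable fun u : Fin d → ℝ => ((1 + ‖u‖ ^ 2) ^ d)⁻¹ :=
    integrable_inv_one_add_norm_sq_pow (by omega)
  have hcont : Continuous fun u : Fin d → ℝ => (profile (Real.sqrt (sqNorm u + σ))).re :=
    Complex.continuous_re.comp (profile.continuous.comp (hsq.add continuous_const).sqrt)
  refine Integrable.mono' (hgi'.const_mul C') hcont.aestronglyMeasurable (Eventually.of_forall fun u => ?_)
  rw [Real.norm_eq_abs]
  have h1 := hf' 1 zero_le_one (sqNorm u + σ) (add_nonneg (sqNorm_nonneg u) hσ)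
  rw [one_mul, one_pow, one_mul] at h1
  refine h1.trans (mul_le_mul_of_nonneg_left ?_ hC'.le)
  apply inv_anti₀ (by positivity)
  exact pow_le_pow_left₀ (by positivity) (by linarith [norm_sq_le_sqNorm u, sqNorm_nonneg u]) d

/-- `w̄(0;σ') = (2π)^{-d}∫f(√(|u|₂²+σ'))du`. [cite: Slade2017, §10.3 (display (10.40))] -/
theorem wbar_zero_eq (σ : ℝ) :
    wbar d σ 0 = ((2 * π) ^ d : ℝ)⁻¹ * ∫ u : Fin d → ℝ, (profile (Real.sqrt (sqNorm u + σ))).re := by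
  unfold wbar
  congr 1
  refine integral_congr_ae (Eventually.of_forall fun u => ?_)
  simp

/-- `w̄(0;σ') ≥ 0` (`f ≥ 0`). [cite: Slade2017, §10.3 ("where Φ is a nonnegative function")] -/
theorem wbar_zero_nonneg (σ : ℝ) : 0 ≤ wbar d σ 0 := by
  rw [wbar_zero_eq]
  exact mul_nonneg (by positivity) (integral_nonneg fun u => profile_re_nonneg _)

/-- **`w̄(0;σ') ≥ c_w > 0` for all `σ' ∈ [0,σ₁]`**, for some `σ₁ > 0`: `f ≥ η` on `[a,b]`, and on
the box `a/√d ≤ u_i ≤ √((a²+b²)/(2d))` one has `√(|u|₂²+σ') ∈ [a,b]` whenever `0 ≤ σ' ≤ (b²-a²)/2`.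
[cite: Slade2017, Lemma 5.2.2 (proof: "with the first term strictly positive")] -/
theorem exists_wbar_zero_ge (hd : 1 ≤ d) :
    ∃ σ₁ cw : ℝ, 0 < σ₁ ∧ 0 < cw ∧ ∀ σ : ℝ, 0 ≤ σ → σ ≤ σ₁ → cw ≤ wbar d σ 0 := by
  have hd' : (0 : ℝ) < d := by exact_mod_cast hd
  obtain ⟨a, b, η, ha, hab, hη, hf⟩ := exists_profile_re_ge
  have hb : 0 < b := by linarith
  set p : ℝ := a / Real.sqrt d with hp
  set q : ℝ := Real.sqrt ((a ^ 2 + b ^ 2) / (2 * d)) with hq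
  have hsd : 0 < Real.sqrt d := Real.sqrt_pos.2 hd'
  have hsd2 : Real.sqrt d ^ 2 = d := Real.sq_sqrt hd'.le
  have hp0 : 0 < p := by positivity
  have hp2 : p ^ 2 = a ^ 2 / d := by rw [hp, div_pow, hsd2]
  have hq2 : q ^ 2 = (a ^ 2 + b ^ 2) / (2 * d) := by rw [hq, Real.sq_sqrt (by positivity)]
  have hq0 : 0 < q := Real.sqrt_pos.2 (by positivity)
  have hpq : p < q := by
    have hab2 : a ^ 2 < b ^ 2 := by nlinarith
    have : p ^ 2 < q ^ 2 := by
      rw [hp2, hq2, div_lt_div_iff₀ hd' (by positivity)]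
      nlinarith [mul_lt_mul_of_pos_right hab2 hd']
    nlinarith
  set σ₁ : ℝ := (b ^ 2 - a ^ 2) / 2 with hσ₁
  have hσ₁0 : 0 < σ₁ := by rw [hσ₁]; nlinarith
  refine ⟨σ₁, ((2 * π) ^ d : ℝ)⁻¹ * (η * (q - p) ^ d), hσ₁0, by
    have : 0 < q - p := by linarith
    positivity, fun σ hσ0 hσ1 => ?_⟩
  rw [wbar_zero_eq]
  refine mul_le_mul_of_nonneg_left ?_ (by positivity)
  -- `∫ ≥ ∫_{box} ≥ η vol(box)`
  set box : Set (Fin d → ℝ) := Set.Icc (fun _ => p) (fun _ => q) with hbox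
  have hint := integrable_profile_sqrt_sqNorm hd hσ0
  have hvol : volume.real box = (q - p) ^ d := by
    rw [Measure.real, hbox, Real.volume_Icc_pi_toReal (fun _ => hpq.le)]
    simp
  have hle_box : ∀ u ∈ box, η ≤ (profile (Real.sqrt (sqNorm u + σ))).re := by
    intro u hu
    rw [hbox, Set.mem_Icc] at hu
    apply hf
    have hui : ∀ i, p ≤ u i ∧ u i ≤ q := fun i => ⟨hu.1 i, hu.2 i⟩
    have hsq_lo : a ^ 2 ≤ sqNorm u := by
      unfold sqNorm
      calc a ^ 2 = ∑ _i : Fin d, a ^ 2 / d := by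
            rw [Finset.sum_const, Finset.card_univ, Fintype.card_fin, nsmul_eq_mul]; field_simp
        _ ≤ ∑ i, u i ^ 2 := Finset.sum_le_sum fun i _ => by
            rw [← hp2]; exact pow_le_pow_left₀ hp0.le (hui i).1 2
    have hsq_hi : sqNorm u ≤ (a ^ 2 + b ^ 2) / 2 := by
      unfold sqNorm
      calc ∑ i, u i ^ 2 ≤ ∑ _i : Fin d, q ^ 2 := Finset.sum_le_sum fun i _ =>
            pow_le_pow_left₀ (hp0.le.trans (hui i).1) (hui i).2 2
        _ = (a ^ 2 + b ^ 2) / 2 := by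
            rw [Finset.sum_const, Finset.card_univ, Fintype.card_fin, nsmul_eq_mul, hq2]; field_simp
    have hX0 : 0 ≤ sqNorm u + σ := add_nonneg (sqNorm_nonneg u) hσ0
    constructor
    · rw [Real.le_sqrt' ha]; linarith
    · rw [Real.sqrt_le_left hb.le]; rw [hσ₁] at hσ1; linarith
  calc η * (q - p) ^ d = ∫ _ in box, η := by rw [setIntegral_const, hvol, smul_eq_mul, mul_comm]
    _ ≤ ∫ u in box, (profile (Real.sqrt (sqNorm u + σ))).re := by
        refine setIntegral_mono_on ?_ hint.integrableOn measurableSet_Icc hle_box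
        have hfin : volume box < ⊤ := by
          rw [hbox, Real.volume_Icc_pi]; exact ENNReal.prod_lt_top fun _ _ => ENNReal.ofReal_lt_top
        exact integrableOn_const hfin.ne
    _ ≤ ∫ u, (profile (Real.sqrt (sqNorm u + σ))).re :=
        setIntegral_le_integral hint (Eventually.of_forall fun u => profile_re_nonneg _)

/-! ### `G_L(0,σ)` is bounded below for small `σ`, and `c₀(0,0) > 0` -/

/-- `G_L(0,σ) ≥ 0` for `σ ≥ 0`. [cite: Slade2017, §10.3 (display (10.40))] -/
theorem cZeroKer_zero_nonneg (hd : 1 ≤ d) {L : ℝ} (hL : 1 ≤ L) (σ : ℝ) :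
    0 ≤ cZeroKer d L 0 σ := by
  unfold cZeroKer
  refine setIntegral_nonneg measurableSet_Ioc fun τ hτ => ?_
  have hL0 : 0 < L := by linarith
  have hτ0 : 0 < τ := lt_trans (by positivity) hτ.1
  unfold cZeroIntegrand
  have e : (fun i : Fin d => Real.sqrt (2 * d) * (0 : Fin d → ℝ) i / τ) = 0 := by funext i; simp
  rw [e]
  have := wbar_zero_nonneg (d := d) (σ * τ ^ 2 / (2 * d))
  have hc := cProfile_pos
  positivity

/-- **`G_L(0,σ) ≥ c_G > 0` for `σ ∈ (0,σ₂]`** (the prefactor `(M₀/τ)^d(τ²/(2dc))/τ ≥ M₀^d/(2dc)` on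
`τ ≤ ½`, and `στ²/(2d) ≤ σ₁`). [cite: Slade2017, Lemma 5.2.2 (proof: "with the first term strictly positive")] -/
theorem exists_cZeroKer_zero_ge (hd : 1 ≤ d) {L : ℝ} (hL : 2 ≤ L) :
    ∃ σ₂ cG : ℝ, 0 < σ₂ ∧ 0 < cG ∧ ∀ σ : ℝ, 0 ≤ σ → σ ≤ σ₂ → cG ≤ cZeroKer d L 0 σ := by
  have hd' : (1 : ℝ) ≤ d := by exact_mod_cast hd
  have hL0 : (0 : ℝ) < L := by linarith
  have hc := cProfile_pos
  obtain ⟨σ₁, cw, hσ₁, hcw, hw⟩ := exists_wbar_zero_ge hd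
  obtain ⟨K, -, hG⟩ := abs_cZeroKer_le hd (by linarith : (1 : ℝ) ≤ L) 0
  have hM0 : 0 < Real.sqrt (2 * d) := Real.sqrt_pos.2 (by positivity)
  set p₀ : ℝ := Real.sqrt (2 * d) ^ d / (cProfile * (2 * d)) with hp₀
  have hp₀0 : 0 < p₀ := by positivity
  refine ⟨8 * d * σ₁, p₀ * cw * (1 / 4), by positivity, by positivity, fun σ hσ0 hσ2 => ?_⟩
  have hab : 1 / (2 * L) ≤ (1 / 2 : ℝ) := by
    rw [div_le_div_iff₀ (by positivity) (by positivity)]; linarith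
  have hpt : ∀ τ ∈ Ioc (1 / (2 * L)) (1 / 2 : ℝ), p₀ * cw ≤ cZeroIntegrand d 0 σ τ := by
    intro τ hτ
    have hτ0 : 0 < τ := lt_trans (by positivity) hτ.1
    have hτ1 : τ ≤ 1 := by linarith [hτ.2]
    unfold cZeroIntegrand
    have e : (fun i : Fin d => Real.sqrt (2 * d) * (0 : Fin d → ℝ) i / τ) = 0 := by funext i; simp
    rw [e]
    -- prefactor ≥ p₀
    have hpref : p₀ ≤ (Real.sqrt (2 * d) / τ) ^ d * (τ ^ 2 / (cProfile * (2 * d))) / τ := by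
      rw [hp₀, div_pow]
      have hτd : τ ^ d * τ ≤ τ ^ 2 := by
        rw [← pow_succ]
        exact pow_le_pow_of_le_one hτ0.le hτ1 (by omega)
      have e2 : Real.sqrt (2 * d) ^ d / τ ^ d * (τ ^ 2 / (cProfile * (2 * d))) / τ =
          Real.sqrt (2 * d) ^ d / (cProfile * (2 * d)) * (τ ^ 2 / (τ ^ d * τ)) := by
        field_simp
      rw [e2]
      refine le_mul_of_one_le_right (by positivity) ?_
      rw [le_div_iff₀ (by positivity), one_mul]
      exact hτd
    -- `w̄ ≥ cw` since `στ²/(2d) ≤ σ/(8d) ≤ σ₁`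
    have hσ' : σ * τ ^ 2 / (2 * d) ≤ σ₁ := by
      rw [div_le_iff₀ (by positivity)]
      have h14 : τ ^ 2 ≤ 1 / 4 := by nlinarith [hτ.2, hτ0]
      nlinarith
    have hwl : cw ≤ wbar d (σ * τ ^ 2 / (2 * d)) 0 := hw _ (by positivity) hσ'
    calc p₀ * cw ≤ ((Real.sqrt (2 * d) / τ) ^ d * (τ ^ 2 / (cProfile * (2 * d))) / τ) *
          wbar d (σ * τ ^ 2 / (2 * d)) 0 := mul_le_mul hpref hwl hcw.le (le_trans hp₀0.le hpref)
      _ = _ := by ring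
  have hfi := (hG σ hσ0 0).1
  have hgi : IntegrableOn (fun _ : ℝ => p₀ * cw) (Ioc (1 / (2 * L)) (1 / 2 : ℝ)) :=
    (continuous_const.integrableOn_Icc).mono_set Ioc_subset_Icc_self
  unfold cZeroKer
  calc p₀ * cw * (1 / 4) ≤ p₀ * cw * (1 / 2 - 1 / (2 * L)) := by
        apply mul_le_mul_of_nonneg_left _ (by positivity)
        have : 1 / (2 * L) ≤ (1 / 4 : ℝ) := by
          rw [div_le_div_iff₀ (by positivity) (by positivity)]; linarith
        linarith
    _ = ∫ _ in Ioc (1 / (2 * L)) (1 / 2 : ℝ), p₀ * cw := by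
        rw [setIntegral_const, smul_eq_mul, Real.volume_real_Ioc_of_le hab, mul_comm]
    _ ≤ ∫ τ in Ioc (1 / (2 * L)) (1 / 2 : ℝ), cZeroIntegrand d 0 σ τ :=
        setIntegral_mono_on hgi hfi measurableSet_Ioc hpt

/-- Kato's density at zero mass: `ρ^{(β)}(s,0) = (sin πβ/π) s^{-β}`.
[cite: Slade2017, §2.1.2 (display (2.10) at m² = 0)] -/
theorem katoDensity_zero_mass {β : ℝ} {s : ℝ} (hs : 0 < s) :
    Kato.katoDensity β 0 s = Real.sin (π * β) / π * s ^ (-β) := by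
  unfold Kato.katoDensity
  have hsb : 0 < s ^ β := Real.rpow_pos_of_pos hs β
  congr 1
  rw [show s ^ (2 * β) = s ^ β * s ^ β by rw [← Real.rpow_add hs]; ring_nf, Real.rpow_neg hs.le]
  field_simp
  ring

/-- **`c₀(0,0) > 0`** ("with the first term strictly positive").
[cite: Slade2017, Lemma 5.2.2 (proof, §10.4)] -/
theorem cZero_zero_zero_pos (hd : 1 ≤ d) {α : ℝ} (hα0 : 0 < α) (hα2 : α < 2) {L : ℝ} (hL : 2 ≤ L) :
    0 < cZero d L α 0 0 := by
  have hβ0 : 0 < α / 2 := by positivity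
  have hβ1 : α / 2 < 1 := by linarith
  have hL1 : (1 : ℝ) ≤ L := by linarith
  obtain ⟨σ₂, cG, hσ₂, hcG, hGge⟩ := exists_cZeroKer_zero_ge hd hL
  have hsin : 0 < Real.sin (π * (α / 2)) := Real.sin_pos_of_pos_of_lt_pi (by positivity)
    (by nlinarith [Real.pi_pos])
  have hint := integrableOn_cZeroKer_mul_katoDensity hd hL1 hβ0 hβ1 0 (0 : Fin d → ℝ)
  -- lower bound of the integrand on `(0, σ₂]`
  set m₀ : ℝ := cG * (Real.sin (π * (α / 2)) / π * σ₂ ^ (-(α / 2))) with hm₀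
  have hm₀0 : 0 < m₀ := by
    have := Real.rpow_pos_of_pos hσ₂ (-(α / 2)); positivity
  have hlow : ∀ s ∈ Ioc (0 : ℝ) σ₂, m₀ ≤ cZeroKer d L 0 s * Kato.katoDensity (α / 2) 0 s := by
    intro s hs
    rw [katoDensity_zero_mass hs.1, hm₀]
    refine mul_le_mul (hGge s hs.1.le hs.2) ?_ (by have := Real.rpow_pos_of_pos hσ₂ (-(α / 2)); positivity)
      ((hcG.le).trans (hGge s hs.1.le hs.2))
    refine mul_le_mul_of_nonneg_left ?_ (by positivity)
    exact Real.rpow_le_rpow_of_nonpos hs.1 hs.2 (by linarith)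
  have hnn : ∀ s ∈ Ioi (0 : ℝ), 0 ≤ cZeroKer d L 0 s * Kato.katoDensity (α / 2) 0 s := fun s hs =>
    mul_nonneg (cZeroKer_zero_nonneg hd hL1 s) (Kato.katoDensity_pos hβ0 hβ1 0 hs).le
  unfold cZero
  calc (0 : ℝ) < m₀ * σ₂ := by positivity
    _ = ∫ _ in Ioc (0 : ℝ) σ₂, m₀ := by
        rw [setIntegral_const, smul_eq_mul, Real.volume_real_Ioc_of_le hσ₂.le, sub_zero, mul_comm]
    _ ≤ ∫ s in Ioc (0 : ℝ) σ₂, cZeroKer d L 0 s * Kato.katoDensity (α / 2) 0 s :=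
        setIntegral_mono_on ((continuous_const.integrableOn_Icc).mono_set Ioc_subset_Icc_self)
          (hint.mono_set Ioc_subset_Ioi_self) measurableSet_Ioc hlow
    _ ≤ ∫ s in Ioi (0 : ℝ), cZeroKer d L 0 s * Kato.katoDensity (α / 2) 0 s :=
        setIntegral_mono_set hint ((ae_restrict_iff' measurableSet_Ioi).2 (Eventually.of_forall hnn))
          (Eventually.of_forall Ioc_subset_Ioi_self)

/-! ### `I_0 = ∫c₀(y,0)² dy > 0` -/

/-- **`I_0 = ⟨c₀,c₀⟩ > 0`** ("with the first term strictly positive"): `c₀(·,0)` is Lipschitz and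
`c₀(0,0) > 0`, so `c₀(y,0) ≥ ½c₀(0,0)` on a sup-norm ball of positive volume.
[cite: Slade2017, Lemma 5.2.2 (proof, §10.4: "with the first term strictly positive")] -/
theorem integral_cZero_sq_pos (hd : 1 ≤ d) {α : ℝ} (hα0 : 0 < α) (hα2 : α < 2) {L : ℝ} (hL : 2 ≤ L) :
    0 < ∫ y : Fin d → ℝ, cZero d L α y 0 * cZero d L α y 0 := by
  have hL1 : (1 : ℝ) ≤ L := by linarith
  have hpos := cZero_zero_zero_pos hd hα0 hα2 hL
  obtain ⟨Lc, hLc, hlip⟩ := abs_cZero_sub_le hd hα0 hα2 hL1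
  obtain ⟨C₀, hC₀, hb⟩ := abs_cZero_le hd hα0 hα2 hL1
  set v : ℝ := cZero d L α 0 0 with hv
  set r : ℝ := v / (2 * Lc) with hr
  have hr0 : 0 < r := by positivity
  -- integrability of `c₀²`: bounded, supported in `‖y‖ ≤ ½`
  have hcont : Continuous fun y : Fin d → ℝ => cZero d L α y 0 := by
    have hl : LipschitzWith (Real.toNNReal Lc) (fun y : Fin d → ℝ => cZero d L α y 0) :=
      LipschitzWith.of_dist_le_mul fun y y' => by
        rw [Real.dist_eq, dist_eq_norm, Real.coe_toNNReal Lc hLc.le]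
        exact hlip 0 y y'
    exact hl.continuous
  have hsupp : Function.support (fun y : Fin d → ℝ => cZero d L α y 0 * cZero d L α y 0) ⊆
      Metric.closedBall (0 : Fin d → ℝ) (1 / 2) := by
    intro y hy
    rw [Metric.mem_closedBall, dist_zero_right]
    by_contra h
    have h1 : 1 / 2 < ∑ i, |y i| := by
      refine lt_of_lt_of_le (lt_of_not_ge h) ?_
      refine (pi_norm_le_iff_of_nonneg (Finset.sum_nonneg fun i _ => abs_nonneg (y i))).2 fun i => ?_
      rw [Real.norm_eq_abs]
      exact Finset.single_le_sum (f := fun j => |y j|) (fun j _ => abs_nonneg _) (Finset.mem_univ i)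
    exact hy (by
      show cZero d L α y 0 * cZero d L α y 0 = 0
      rw [cZero_eq_zero_of_half_lt hd hα0 hα2 hL h1 0, zero_mul])
  have hFi : Integrable fun y : Fin d → ℝ => cZero d L α y 0 * cZero d L α y 0 :=
    (integrableOn_iff_integrable_of_support_subset hsupp).1
      ((hcont.mul hcont).continuousOn.integrableOn_compact (isCompact_closedBall 0 (1 / 2)))
  -- lower bound on the ball of radius `r`
  have hlow : ∀ y ∈ Metric.closedBall (0 : Fin d → ℝ) r, (v / 2) ^ 2 ≤ cZero d L α y 0 * cZero d L α y 0 := by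
    intro y hy
    rw [Metric.mem_closedBall, dist_zero_right] at hy
    have h1 := hlip 0 y 0
    rw [sub_zero] at h1
    have h2 : Lc * ‖y‖ ≤ v / 2 := by
      calc Lc * ‖y‖ ≤ Lc * r := mul_le_mul_of_nonneg_left hy hLc.le
        _ = v / 2 := by rw [hr]; field_simp
    have h3 : v / 2 ≤ cZero d L α y 0 := by
      have := (abs_le.1 (h1.trans h2)).1
      rw [hv] at this ⊢; linarith
    rw [sq]
    exact mul_le_mul h3 h3 (by positivity) (le_trans (by positivity) h3)
  have hfin : volume (Metric.closedBall (0 : Fin d → ℝ) r) < ⊤ := by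
    rw [Real.volume_pi_closedBall _ hr0.le]; exact ENNReal.ofReal_lt_top
  calc (0 : ℝ) < (v / 2) ^ 2 * (2 * r) ^ d := by positivity
    _ = ∫ _ in Metric.closedBall (0 : Fin d → ℝ) r, (v / 2) ^ 2 := by
        rw [setIntegral_const, smul_eq_mul, Measure.real, Real.volume_pi_closedBall _ hr0.le,
          ENNReal.toReal_ofReal (by positivity), mul_comm]
        simp
    _ ≤ ∫ y in Metric.closedBall (0 : Fin d → ℝ) r, cZero d L α y 0 * cZero d L α y 0 :=
        setIntegral_mono_on (integrableOn_const hfin.ne) hFi.integrableOn Metric.isClosed_closedBall.measurableSet hlow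
    _ ≤ ∫ y, cZero d L α y 0 * cZero d L α y 0 :=
        setIntegral_le_integral hFi (Eventually.of_forall fun y => mul_self_nonneg _)

end FRD

end LongRangePhi4

end Literature.Barriers.CriticalPhenomena
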